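import Summits.CriticalPhenomena.PercolationContinuityZ3.Theorems.Transplant.PlanarSkeletonConcDefs
import Summits.CriticalPhenomena.PercolationContinuityZ3.Theorems.Transplant.PlanarSkeletonPrisms
import Summits.CriticalPhenomena.PercolationContinuityZ3.Theorems.Transplant.KNCells2FacePrefix
import HarnessLib

/-!
# L3.1 (part 1): VERTEX-SPAN windows over a `PlanarSkeletonConc` — the regions of record of the generic (D) re-typing are the spans
# `vspan (edgesIn G (Win P R))` of the coordinate-free windows (SHEAR-SCOPE §p3 3.0 item 3(B), §p2 2.5, lead g3 17:48:43Z L3.1)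

builds on p205010 (kernel theorem, internal audit signed; external expert review pending) — nothing in this file uses p205010.
Lane `prim-bschramm-*`, seat `prim-bschramm-p2` (gen 3); helper file (`--supports stmt-CriticalPhenomena-4575`).

The generic Kozma–Nitzan layer (`KNCells*`) asks of every region of a cell geometry that each of its vertices have a `G`-neighbour INSIDE
the region (`RunGeom`: the explored vertex set is the span of the revealed edges, `KNCellsRunInv.vspan_edgesIn_eq`).  A coordinate-free
window `Win P R = {g : d_G(w₀,g) ≤ R, φ g ∈ P}` (stmt-g6, `PlanarSkeletonConcDefs`) need not have this property at its graph-distance rim;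
its vertex span `VWin P R := vspan (edgesIn G (Win P R))` has it by construction, lies in the window, has the same inside edges (so every
law restricted to `edgesIn` is unchanged), and inherits every containment / disjointness / separation through `φ`.  This file is the toolkit;
the cell geometry of record over these spans (`SkelCellsConcG`) is part 2.
* `PlanarSkeletonConc.VWin / VStair` + `mem` lemmas, `VWin_subset_Win`, `φ_mem_of_mem_VWin`, `mem_graphBall_of_mem_VWin`, monotonicity,
  disjointness from planar disjointness, `Sep` from p3-g4's planar ℓ^∞-gap `SepInf` (`PlanarSkeleton.sep_of_sepInf`);
* **`exists_adj_of_mem_VWin` / `exists_adj_of_mem_VStair`** — the `RunGeom` property, for free;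
* `edgesIn_VWin` — `edgesIn G (VWin P R) = edgesIn G (Win P R)` (the law side is untouched);
* the STEP lemmas: `exists_adj_φ_eq` (field (ι) `step`), **`mem_VWin_of_step`** — a vertex of depth `≤ R - 1` over `P` whose planar unit
  neighbour `φ y + σ e_i` lies in `P` belongs to `VWin P R` (the "+1 slack" device behind every union containment of part 2).
[cite: KozmaNitzan2024, §4 pp. 25–27 ((29), E_{i+1})] [cite: GrimmettPercolation1999, §7.2]
-/

noncomputable section

open scoped Classical

namespace Summit.CriticalPhenomena.PercolationContinuityZ3.Theorems

namespace Transplant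

namespace PlanarSkeletonConc

open Literature.Probability.Percolation Literature.Probability.LatticeModels SimpleGraph KNCells
open Literature.Barriers.CriticalPhenomena (graphBall graphBall_finite mem_graphBall_self graphBall_mono)

variable {V : Type} [DecidableEq V] {G : SimpleGraph V} [G.LocallyFinite] (Φ : PlanarSkeletonConc G)

/-! ## §1 Vertex spans of windows and staircase windows -/

/-- **The vertex span of a window**: the vertices of the edges of `G` with both endpoints in `Win w₀ P R` — the region of record over the
planar set `P` at fibre depth `R`. [this work] -/
def VWin (w₀ : V) (P : Finset (Site 2)) (R : ℕ) : Finset V := vspan (edgesIn G (Φ.Win w₀ P R))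

/-- **The vertex span of a staircase window** (profile `ρ`). [this work] -/
def VStair (w₀ : V) (P : Finset (Site 2)) (ρ : Site 2 → ℕ) : Finset V := vspan (edgesIn G (Φ.stair w₀ P ρ))

variable {Φ}

/-- Membership in a vertex span of edges inside `X`: an inside edge at the vertex. [folklore] -/
theorem mem_vspan_edgesIn_iff {X : Finset V} {y : V} : y ∈ vspan (edgesIn G X) ↔ y ∈ X ∧ ∃ z ∈ X, G.Adj y z := by
  constructor
  · intro hy
    exact ⟨vspan_edgesIn_subset X hy, exists_adj_of_mem_vspan_edgesIn hy⟩
  · rintro ⟨hy, z, hz, hadj⟩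
    refine mem_vspan_iff.2 ⟨s(y, z), ?_, Sym2.mem_mk_left _ _⟩
    rw [mem_edgesIn_iff]
    refine ⟨(SimpleGraph.mem_edgeSet G).2 hadj, fun x hx => ?_⟩
    rcases Sym2.mem_iff.1 hx with rfl | rfl
    · exact hy
    · exact hz

/-- A vertex with an inside neighbour lies in the span, and so does the neighbour. [folklore] -/
theorem mem_vspan_edgesIn_of_adj {X : Finset V} {y z : V} (hy : y ∈ X) (hz : z ∈ X) (h : G.Adj y z) :
    y ∈ vspan (edgesIn G X) ∧ z ∈ vspan (edgesIn G X) :=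
  ⟨mem_vspan_edgesIn_iff.2 ⟨hy, z, hz, h⟩, mem_vspan_edgesIn_iff.2 ⟨hz, y, hy, h.symm⟩⟩

/-- **Every vertex of a span has a `G`-neighbour in the span** (the `RunGeom` property). [folklore] -/
theorem exists_adj_of_mem_vspan_edgesIn' {X : Finset V} {y : V} (hy : y ∈ vspan (edgesIn G X)) :
    ∃ z ∈ vspan (edgesIn G X), G.Adj y z := by
  obtain ⟨hyX, z, hz, hadj⟩ := mem_vspan_edgesIn_iff.1 hy
  exact ⟨z, (mem_vspan_edgesIn_of_adj hyX hz hadj).2, hadj⟩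

/-- **The span has the same inside edges as the set** (so every law `restrW (edgesIn …)` is unchanged by passing to spans). [folklore] -/
theorem edgesIn_vspan_edgesIn (X : Finset V) : edgesIn G (vspan (edgesIn G X)) = edgesIn G X := by
  ext e
  constructor
  · intro he
    rw [mem_edgesIn_iff] at he ⊢
    exact ⟨he.1, fun x hx => vspan_edgesIn_subset X (he.2 x hx)⟩
  · intro he
    rw [mem_edgesIn_iff] at he ⊢
    refine ⟨he.1, fun x hx => mem_vspan_iff.2 ⟨e, ?_, hx⟩⟩
    rw [mem_edgesIn_iff]; exact he

/-- Spans are monotone. [folklore] -/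
theorem vspan_edgesIn_mono {X Y : Finset V} (h : X ⊆ Y) : vspan (edgesIn G X) ⊆ vspan (edgesIn G Y) := by
  intro y hy
  obtain ⟨hyX, z, hz, hadj⟩ := mem_vspan_edgesIn_iff.1 hy
  exact mem_vspan_edgesIn_iff.2 ⟨h hyX, z, h hz, hadj⟩

/-! ### Membership, containment, monotonicity -/

/-- `VWin ⊆ Win`. [folklore] -/
theorem VWin_subset_Win (w₀ : V) (P : Finset (Site 2)) (R : ℕ) : Φ.VWin w₀ P R ⊆ Φ.Win w₀ P R := vspan_edgesIn_subset _

/-- `VStair ⊆ stair`. [folklore] -/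
theorem VStair_subset_stair (w₀ : V) (P : Finset (Site 2)) (ρ : Site 2 → ℕ) : Φ.VStair w₀ P ρ ⊆ Φ.stair w₀ P ρ := vspan_edgesIn_subset _

/-- The planar footprint of a vertex of `VWin P R` lies in `P`. [folklore] -/
theorem φ_mem_of_mem_VWin {w₀ : V} {P : Finset (Site 2)} {R : ℕ} {y : V} (hy : y ∈ Φ.VWin w₀ P R) : Φ.φ y ∈ P :=
  (Φ.mem_Win.1 (Φ.VWin_subset_Win w₀ P R hy)).2

/-- A vertex of `VWin P R` has depth `≤ R`. [folklore] -/
theorem mem_graphBall_of_mem_VWin {w₀ : V} {P : Finset (Site 2)} {R : ℕ} {y : V} (hy : y ∈ Φ.VWin w₀ P R) :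
    y ∈ graphBall G w₀ R :=
  (Φ.mem_Win.1 (Φ.VWin_subset_Win w₀ P R hy)).1

/-- The planar footprint of a vertex of `VStair P ρ` lies in `P`, its depth is `≤ ρ (φ y)`. [folklore] -/
theorem mem_of_mem_VStair {w₀ : V} {P : Finset (Site 2)} {ρ : Site 2 → ℕ} {y : V} (hy : y ∈ Φ.VStair w₀ P ρ) :
    Φ.φ y ∈ P ∧ y ∈ graphBall G w₀ (ρ (Φ.φ y)) :=
  Φ.mem_stair.1 (Φ.VStair_subset_stair w₀ P ρ hy)

/-- `RunGeom` for window spans. [folklore] -/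
theorem exists_adj_of_mem_VWin {w₀ : V} {P : Finset (Site 2)} {R : ℕ} {y : V} (hy : y ∈ Φ.VWin w₀ P R) :
    ∃ z ∈ Φ.VWin w₀ P R, G.Adj y z :=
  exists_adj_of_mem_vspan_edgesIn' hy

/-- `RunGeom` for staircase spans. [folklore] -/
theorem exists_adj_of_mem_VStair {w₀ : V} {P : Finset (Site 2)} {ρ : Site 2 → ℕ} {y : V} (hy : y ∈ Φ.VStair w₀ P ρ) :
    ∃ z ∈ Φ.VStair w₀ P ρ, G.Adj y z :=
  exists_adj_of_mem_vspan_edgesIn' hy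

/-- The inside edges of a window span are those of the window. [folklore] -/
theorem edgesIn_VWin (w₀ : V) (P : Finset (Site 2)) (R : ℕ) : edgesIn G (Φ.VWin w₀ P R) = edgesIn G (Φ.Win w₀ P R) :=
  edgesIn_vspan_edgesIn _

/-- Window spans grow with the planar set and the depth. [folklore] -/
theorem VWin_mono {w₀ : V} {P P' : Finset (Site 2)} (hP : P ⊆ P') {R R' : ℕ} (hR : R ≤ R') : Φ.VWin w₀ P R ⊆ Φ.VWin w₀ P' R' :=
  vspan_edgesIn_mono (Φ.Win_mono hP hR)

/-- Staircase spans grow with the planar set and the profile. [folklore] -/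
theorem VStair_mono {w₀ : V} {P P' : Finset (Site 2)} (hP : P ⊆ P') {ρ ρ' : Site 2 → ℕ} (hρ : ∀ t ∈ P, ρ t ≤ ρ' t) :
    Φ.VStair w₀ P ρ ⊆ Φ.VStair w₀ P' ρ' := by
  refine vspan_edgesIn_mono fun g hg => ?_
  rw [Φ.mem_stair] at hg ⊢
  exact ⟨hP hg.1, graphBall_mono G w₀ (hρ _ hg.1) hg.2⟩

/-- A staircase span under a uniform profile bound lies in the window span. [folklore] -/
theorem VStair_subset_VWin {w₀ : V} {P P' : Finset (Site 2)} (hP : P ⊆ P') {ρ : Site 2 → ℕ} {R : ℕ} (hρ : ∀ t ∈ P, ρ t ≤ R) :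
    Φ.VStair w₀ P ρ ⊆ Φ.VWin w₀ P' R := by
  refine vspan_edgesIn_mono fun g hg => ?_
  rw [Φ.mem_stair] at hg
  rw [Φ.mem_Win]
  exact ⟨graphBall_mono G w₀ (hρ _ hg.1) hg.2, hP hg.1⟩

/-! ### Disjointness and separation through the skeleton map -/

omit [DecidableEq V] in
/-- Two vertex sets with planar footprints in disjoint planar sets are disjoint. [folklore] -/
theorem disjoint_of_φ {X Y : Finset V} {P P' : Finset (Site 2)} (hX : ∀ a ∈ X, Φ.φ a ∈ P) (hY : ∀ b ∈ Y, Φ.φ b ∈ P')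
    (h : Disjoint P P') : Disjoint X Y :=
  Finset.disjoint_left.2 fun a haX haY => Finset.disjoint_left.1 h (hX a haX) (hY a haY)

/-- Window spans over disjoint planar sets are disjoint. [folklore] -/
theorem disjoint_VWin {w₀ : V} {P P' : Finset (Site 2)} (h : Disjoint P P') (R R' : ℕ) :
    Disjoint (Φ.VWin w₀ P R) (Φ.VWin w₀ P' R') :=
  disjoint_of_φ (fun _ ha => φ_mem_of_mem_VWin ha) (fun _ hb => φ_mem_of_mem_VWin hb) h

/-- A staircase span and a window span over disjoint planar sets are disjoint. [folklore] -/
theorem disjoint_VStair_VWin {w₀ : V} {P P' : Finset (Site 2)} (h : Disjoint P P') (ρ : Site 2 → ℕ) (R' : ℕ) :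
    Disjoint (Φ.VStair w₀ P ρ) (Φ.VWin w₀ P' R') :=
  disjoint_of_φ (fun _ ha => (mem_of_mem_VStair ha).1) (fun _ hb => φ_mem_of_mem_VWin hb) h

/-- **No-edge separation of window spans from planar ℓ^∞-gap separation** (p3-g4's `sep_of_sepInf`). [cite: KozmaNitzan2024, §4 p. 26 ((29))] -/
theorem sep_VWin_of_sepInf {w₀ : V} {P P' : Finset (Site 2)} (h : PlanarSkeleton.SepInf (↑P : Set (Site 2)) ↑P') (R R' : ℕ) :
    KNCells.Sep G (Φ.VWin w₀ P R) (Φ.VWin w₀ P' R') :=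
  PlanarSkeleton.sep_of_sepInf Φ.toPlanarSkeleton h (fun _ ha => φ_mem_of_mem_VWin ha) (fun _ hb => φ_mem_of_mem_VWin hb)

/-! ## §2 The step device -/

omit [DecidableEq V] in
/-- A unit planar neighbour of `φ y` is the footprint of a `G`-neighbour of `y` (field (ι) `step`). [folklore] -/
theorem exists_adj_φ_eq (y : V) (i : Fin 2) (σ : ℤˣ) : ∃ y', G.Adj y y' ∧ Φ.φ y' = Φ.φ y + Pi.single i (σ : ℤ) :=
  Φ.step y i σ

/-- **The +1-slack membership device**: a vertex `y` of depth `≤ n` with `n + 1 ≤ R`, footprint in `P`, and a planar unit neighbour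
`φ y + σ e_i ∈ P`, lies in the span `VWin P R` (the edge to the `step`-neighbour over `φ y + σ e_i` is inside `Win P R`). [this work] -/
theorem mem_VWin_of_step {w₀ : V} {P : Finset (Site 2)} {R n : ℕ} {y : V} (hy : y ∈ graphBall G w₀ n) (hn : n + 1 ≤ R)
    (hP : Φ.φ y ∈ P) {i : Fin 2} {σ : ℤˣ} (hP' : Φ.φ y + Pi.single i (σ : ℤ) ∈ P) : y ∈ Φ.VWin w₀ P R := by
  obtain ⟨y', hadj, hφ⟩ := exists_adj_φ_eq (Φ := Φ) y i σ
  refine (mem_vspan_edgesIn_of_adj ?_ ?_ hadj).1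
  · exact Φ.mem_Win.2 ⟨graphBall_mono G w₀ (by omega) hy, hP⟩
  · exact Φ.mem_Win.2 ⟨graphBall_mono G w₀ hn (BoxProdZ2.mem_graphBall_succ_of_adj G hy hadj), hφ ▸ hP'⟩

/-- The same with the depth read off a window span `VWin P₀ R₀`, `R₀ + 1 ≤ R`. [this work] -/
theorem mem_VWin_of_mem_VWin_of_step {w₀ : V} {P₀ P : Finset (Site 2)} {R₀ R : ℕ} {y : V} (hy : y ∈ Φ.VWin w₀ P₀ R₀)
    (hR : R₀ + 1 ≤ R) (hP : Φ.φ y ∈ P) {i : Fin 2} {σ : ℤˣ} (hP' : Φ.φ y + Pi.single i (σ : ℤ) ∈ P) : y ∈ Φ.VWin w₀ P R :=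
  mem_VWin_of_step (mem_graphBall_of_mem_VWin hy) hR hP hP'

/-- The same with the depth read off a staircase span (profile value at the footprint `+ 1 ≤ R`). [this work] -/
theorem mem_VWin_of_mem_VStair_of_step {w₀ : V} {P₀ P : Finset (Site 2)} {ρ : Site 2 → ℕ} {R : ℕ} {y : V}
    (hy : y ∈ Φ.VStair w₀ P₀ ρ) (hR : ρ (Φ.φ y) + 1 ≤ R) (hP : Φ.φ y ∈ P) {i : Fin 2} {σ : ℤˣ}
    (hP' : Φ.φ y + Pi.single i (σ : ℤ) ∈ P) : y ∈ Φ.VWin w₀ P R :=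
  mem_VWin_of_step (mem_of_mem_VStair hy).2 hR hP hP'

/-- **Seam device**: a vertex of a span all of whose inside edges have BOTH endpoints' footprints in `P₁` or both in `P₂`, with depths
within `R₁` resp. `R₂`, lies in `VWin P₁ R₁ ∪ VWin P₂ R₂` (no slack needed). [this work] -/
theorem mem_union_VWin_of_seam {w₀ : V} {X : Finset V} {P₁ P₂ : Finset (Site 2)} {R₁ R₂ : ℕ} {y : V}
    (hy : y ∈ vspan (edgesIn G X))
    (hseam : ∀ z ∈ X, y ∈ X → G.Adj y z →
      (y ∈ Φ.Win w₀ P₁ R₁ ∧ z ∈ Φ.Win w₀ P₁ R₁) ∨ (y ∈ Φ.Win w₀ P₂ R₂ ∧ z ∈ Φ.Win w₀ P₂ R₂)) :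
    y ∈ Φ.VWin w₀ P₁ R₁ ∪ Φ.VWin w₀ P₂ R₂ := by
  obtain ⟨hyX, z, hz, hadj⟩ := mem_vspan_edgesIn_iff.1 hy
  rcases hseam z hz hyX hadj with ⟨h1, h2⟩ | ⟨h1, h2⟩
  · exact Finset.mem_union_left _ (mem_vspan_edgesIn_of_adj h1 h2 hadj).1
  · exact Finset.mem_union_right _ (mem_vspan_edgesIn_of_adj h1 h2 hadj).1

omit [DecidableEq V] in
/-- Along an edge of `G` each skeleton coordinate moves by at most one (`lip`, restated for `PlanarSkeletonConc`). [folklore] -/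
theorem abs_φ_sub_φ_le_one {y z : V} (h : G.Adj y z) (i : Fin 2) : |Φ.φ y i - Φ.φ z i| ≤ 1 := Φ.lip h i

/-- **The root lies in the span of its window** as soon as the window has depth `≥ 1` and contains a planar unit neighbour of `φ w₀`.
[folklore] -/
theorem root_mem_VWin {w₀ : V} {P : Finset (Site 2)} {R : ℕ} (hR : 1 ≤ R) (hP : Φ.φ w₀ ∈ P) {i : Fin 2} {σ : ℤˣ}
    (hP' : Φ.φ w₀ + Pi.single i (σ : ℤ) ∈ P) : w₀ ∈ Φ.VWin w₀ P R :=
  mem_VWin_of_step (mem_graphBall_self G w₀ 0) (by omega) hP hP'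

/-- **The column point**: under `step`, the planar point `x ∈ P` is the footprint of a vertex of `VWin P R` once `R` exceeds the planar
ℓ¹-offset of `x` from `φ w₀` by one and `x` has a planar unit neighbour in `P` (p3-g4's `exists_mem_graphBall_φ_eq` + the step device).
[cite: KozmaNitzan2024, §4 p. 26 ((29): the column of x inside Q_x)] -/
theorem exists_mem_VWin_φ_eq {w₀ : V} {P : Finset (Site 2)} {x : Site 2} (hx : x ∈ P) {i : Fin 2} {σ : ℤˣ}
    (hx' : x + Pi.single i (σ : ℤ) ∈ P) {R : ℕ} (hR : (x 0 - Φ.φ w₀ 0).natAbs + (x 1 - Φ.φ w₀ 1).natAbs + 1 ≤ R) :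
    ∃ y ∈ Φ.VWin w₀ P R, Φ.φ y = x := by
  obtain ⟨g, hg, hφ⟩ := PlanarSkeleton.exists_mem_graphBall_φ_eq Φ.toPlanarSkeleton Φ.step w₀ x
  refine ⟨g, mem_VWin_of_step hg hR (by rw [show Φ.φ g = x from hφ]; exact hx) (i := i) (σ := σ) ?_, hφ⟩
  rw [show Φ.φ g = x from hφ]; exact hx'

end PlanarSkeletonConc

end Transplant

end Summit.CriticalPhenomena.PercolationContinuityZ3.Theorems

end
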